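import Literature.MathematicalPhysics.QuantumFieldTheory.Balaban1983to89.B13Ineq220Torus

/-!
# `Balaban1983to89.B13Lemma3TorusBinders` — T. Bałaban, *Renormalization group approach to lattice gauge field theories.
II. Cluster expansions*, Commun. Math. Phys. **116** (1988) 1–22, doi:10.1007/bf01239022 [Balaban1988RG2Cluster]:
the two LOCATED-ROUTINE binders of the torus (2.26) capstone `B13Lemma3TorusPrimitive.h226_torus_of_primitives` that
were still hypotheses after `B13Ineq220Torus` — (2.22) p. 16 for the PRODUCT of the (2.3) characteristic functions
(`h222`), and the geometric input G6 of (2.19) ON THE TORUS (the diameter of a face-connected family of cubes of the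
periodic carrier, hypothesis `hG6` of `B13Ineq220Torus.sum_tau_norm_V_le_of_lemma2`) — PROVED, and (2.18)–(2.20) on the
torus from Lemma 2 with the bonds located AT THEIR CUBES and G6 DISCHARGED, the «O(1)» of (2.20) absolute

statement-level skeleton of published theorems with citation tags; proofs where landed; nothing here is a claim about
the Yang–Mills mass gap

PDF held: `paper:balaban1988-cmp116-rg-ii-cluster` (journal page = PDF page + 0); pp. 12, 16 read this session from the
renders `run/shared/lean/pub/pub-balaban/b2b-balaban-ref1/pages/1988-cmp116-rg-II-cluster/1988-cmp116-rg-II-cluster-p016-x2.png`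
(p. 16; text layer `p0016.txt` drops the displays) and the tree's verbatim quotation of (2.3) p. 12 (`B13MayerDecoupling`).

CITATION HEADER (verbatim).  p. 12 [PDF 12] (2.3): *"χ_k = χ_{k,Y₀}χ_{k,Y₀ᶜ} = Σ_{P⊂Y₀^{c*}} (−1)^{|P|} χ_{k,Y₀} χᶜ_{k,P},
χᶜ_{k,P} = Π_{b∈P} χ({|B(b)| ≧ ε₁/g_k})"* (quoted in `B13MayerDecoupling`, (2.3) = `charFn_decomposition_23`); p. 16
[PDF 16] (2.22): *"Finally we estimate χ_{k,Y₀}(B)χᶜ_{k,P}(B) ≦ exp(−½γ₂(ε₁²/g_k²)|P| + ½γ₂‖PB‖²), (2.22) where γ₂ is a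
small, positive constant."*; p. 16 (2.19)–(2.20): *"The quadratic form in (1.42), after multiplication by |τ(Y)|, can be
bounded by ½ Σ_{b,b′⊂Y} α₄M⁻⁴exp(−¼(κ₁ − 1)M⁻⁴|Y| − (1/16)(κ₁ − 1)M⁻¹|b₋ − b′₋|)|B(b)||B(b′)|. (2.19) The sum of these
quadratic forms over Y∈𝐃 is bounded by a quadratic form with the above matrix elements resummed over all Y∈𝐃_k
containing, for example, the point b₋. We use the first exponential factor in (2.19) to bound the sum, and this yields a
constant O(1). In fact the constant is small for κ₁ large, hence we can bound it by 1."*; [I] = [Balaban1987RG1] p. 257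
(quoted in `B13DiameterG6`): *"A connected family means that for every pair □, □′ of cubes from the family there exists
a sequence □, □₁, …, □_n, □′ of cubes belonging to the family and such that two consecutive cubes have a common wall"*;
[I] p. 251: the carrier is a torus.

WHAT IS REPRODUCED (cell `pub-ymgap`, HUMAN RULING D-0062 Track A, DAG node N10 = [B13], seat `pub-ymgap-dag-n10-b`;
a NEW LEAF over `B13Ineq220Torus` (same seat), nothing there modified).  THIS FILE:
* §1 **`prod_indicator_le_exp_222`**, **`h222_of_charFns`**, `sum_sq_le_dotProduct` — (2.22) for the PRODUCT
  `χ_{k,Y₀}·χᶜ_{k,P}` with `χ_{k,Y₀} ∈ [0, 1]` and `χᶜ_{k,P} = Π_{b∈P} χ(|B(b)| ≥ r)` (per-bond factor: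
  `B13.indicator_le_exp_222`): `χ_{Y₀}χᶜ_P ≤ exp(−½γ₂r²|P| + ½γ₂Σ_{b∈P}B(b)²)`, `Σ_{b∈P}B(b)² ≤ B⬝B` — the letters `h222`,
  `hqP` of the capstone;
* §2 **G6 ON THE TORUS at cube resolution** [folklore geometry + cite]: the cube chart `□ ↦ ((ZMod.finEquiv n)⁻¹ ∘ □)`
  of the cube torus `TPt d n = (ℤ/n)^d` into the site torus `UT (n, …, n)`; a common wall costs ≤ 1 in the ℓ¹ torus
  distance (`tdist1_chart_le_one_of_tadj`); hence for a torus-face-connected family `S` and two of its cubes,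
  `d₁(chart □, chart □′) ≤ #S − 1` (`tdist1_chart_le_card_sub_one`: the chain of [I] p. 257 shortened to a path in the
  wall graph, `SimpleGraph.Walk.bypass`) — the torus twin of `B13DiameterG6.l1_le_card_sub_one`;
* §3 **`ineq220_torus_rho`**, **`sum_tau_norm_V_le_of_lemma2_rho`** — `B13Ineq220Torus.ineq220_torus` /
  `sum_tau_norm_V_le_of_lemma2` with an ABSTRACT symmetric distance reading `ρ` on the bonds (row-sum bound `C` and G6 as
  hypotheses), so that other locations than sites can be used;
* §4 **`sum_tau_norm_V_le_of_lemma2_cubes`** — THE PRINTED (2.20) `Σ_{Y∈𝐃}|τ(Y)||𝐕_k(Y,B)| ≤ …` ON THE TORUS FROM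
  LEMMA 2 with the bonds located AT THEIR CUBES and the distance reading `ρ(b, b′) = M·d₁(chart □(b), chart □(b′))`
  (admissible in (2.19): `ρ ≤ M(#Y − 1) ≤ 4M·M⁻⁴|Y|` by §2, `B13Bound143.elem219_of_bound143`): G6 DISCHARGED, row sum
  `≤ m·α₄·M⁻⁴·(1 + 32/(κ₁−1))⁴` for ≤ m bonds per cube (for the record m = 4M⁴: the ABSOLUTE `4α₄(1 + 32/(κ₁−1))⁴`,
  `rowConst_cubes_abs`), V″-constant `K₀(64, 8)`.  Remaining hypotheses = Lemma 2's three conjuncts of the record, R12,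
  numbers, and the pin's identifications (`emb`, `ι`, `cube`, support of `Q`, `V = W.V ∘ emb` on (1.34));
* §5 **`h226_torus_of_primitives_of_lemma2`** — THE CAPSTONE WITH ITS LEMMA-2 BINDERS DISCHARGED: r10's
  `B13Lemma3TorusPrimitive.h226_torus_of_primitives` (d = 4) with `h222`, `hqP`, `h220R`, `ha0`, `hχc0` replaced by
  Lemma 2 of the record + the structure of the (2.3) characteristic functions + the pin's identifications (the small-field
  truncation of §4 of `B13Ineq220Torus` made invisible by `χ_{k,Y₀}`), the constants `a₂₀ = m′·α₄·M⁻⁴(1 + 32/(κ₁−1))⁴`,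
  `w = K₀(64, 8)·α₄·#(⋃𝐃)` substituted in the smallness / volume conditions; conclusion = the `h226` letter of
  `B13Lemma3TorusTerms.hrep_of_termwise` for the term, unchanged.
HONEST SCOPE.  (a) Print's (2.19) carries the SITE distance |b₋ − b′₋|; §4 uses the cube-scaled reading `M·d₁(□, □′)`,
which is derived from (1.43) by the same affordability step (`elem219_of_bound143` holds for every reading ≤ 4M·M⁻⁴|Y|) and
yields an absolute O(1) as print asserts; the site-resolution G6 (d₁(b₋, b′₋) ≤ M·d₁(□, □′) + 4(M − 1)) is not needed and
not proved here (ℤ^d: `B13DiameterG6`).  (b) By assertion/identification as in `B13Ineq220Torus` (pin data); numbers: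
R12, κ₁ ≥ 1 + 4 log 162, δκ ≥ 64 log 162, M ≥ 1, E₀, ε₁, C₁, α₄ > 0, C₃ ≥ 0.  (c) NOT a discharge of node N10; object
level (NODE O) untouched.  One finite T⁴; Bałaban AS PRINTED; nothing continuum ∕ OS ∕ mass-gap ∕ Clay.  No `sorry`, no
definition (the chart and the wall graph are terms: `ZMod.finEquiv`, `SimpleGraph.fromRel`), no new named fact (D-0026).
-/

noncomputable section

namespace Literature.MathematicalPhysics.QuantumFieldTheory.Balaban1983to89.B13Lemma3TorusBinders

open Finset
open Literature.MathematicalPhysics.QuantumFieldTheory.Balaban1983to89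
open Literature.MathematicalPhysics.QuantumFieldTheory.Balaban1983to89.TreeLengthTorus
open Literature.MathematicalPhysics.QuantumFieldTheory.Balaban1983to89.B12TreeDecay (kappa₀ K₀ a₀)
open Literature.MathematicalPhysics.QuantumFieldTheory.Balaban1983to89.B13Lemma3Torus (TwoTorusStep)
open Literature.MathematicalPhysics.QuantumFieldTheory.Balaban1983to89.B13Bound143 (invTau invTau_pos elem219 R12
  elem219_of_bound143)
open Literature.MathematicalPhysics.QuantumFieldTheory.Balaban1983to89.B13Resum220 (ker220 vpp220 ker220_eq
  ker220_nonneg ineq220 vpp_of_bound136)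
open Literature.MathematicalPhysics.QuantumFieldTheory.Balaban1983to89.B5TorusCover (UT)
open Literature.MathematicalPhysics.QuantumFieldTheory.Balaban1983to89.B9Thm37GlueTorus
  (tdist1 tdist1_comm tdist1_self tdist1_triangle tdist1_nonneg tdist1_up_le)
open Literature.MathematicalPhysics.QuantumFieldTheory.Balaban1983to89.B5Leibniz121 (up)
open Literature.MathematicalPhysics.QuantumFieldTheory.Balaban1983to89.B13Lemma3TorusPrimitive (kc_tdist1)
open Literature.MathematicalPhysics.QuantumFieldTheory.Balaban1983to89.B13Bound226Located (sum_exp_neg_loc_le_pt)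
open Literature.MathematicalPhysics.QuantumFieldTheory.Balaban1983to89.B13Ineq220Torus (norm_quadForm_le_sum_bonds)
open Literature.Probability.LatticeModels (IsRConnected)

/-! ## §1. (2.22) for the product of the (2.3) characteristic functions -/

section Ineq222

variable {Λ : Type*}

/-- **(2.22) for the product `χᶜ_{k,P} = Π_{b∈P} χ(|B(b)| ≥ r)`** (p. 16; per-bond factor `B13.indicator_le_exp_222`):
`Π_{b∈P} χ(r ≤ |B(b)|) ≤ exp(−½γ₂r²|P| + ½γ₂ Σ_{b∈P} B(b)²)` for `γ₂, r ≥ 0` (print: `r = ε₁/g_k`).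
[cite: Balaban1988RG2Cluster, (2.22) p.16] -/
theorem prod_indicator_le_exp_222 (P : Finset Λ) (B : Λ → ℝ) {r γ₂ : ℝ} (hγ : 0 ≤ γ₂) (hr : 0 ≤ r) :
    ∏ b ∈ P, (if r ≤ |B b| then (1 : ℝ) else 0) ≤
      Real.exp (-(γ₂ / 2 * r ^ 2 * (P.card : ℕ)) + γ₂ / 2 * ∑ b ∈ P, B b ^ 2) := by
  calc ∏ b ∈ P, (if r ≤ |B b| then (1 : ℝ) else 0) ≤ ∏ b ∈ P, Real.exp (γ₂ / 2 * (B b ^ 2 - r ^ 2)) :=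
        prod_le_prod (fun b _ => by split_ifs <;> norm_num) fun b _ => B13.indicator_le_exp_222 (B b) r γ₂ hγ hr
    _ = Real.exp (-(γ₂ / 2 * r ^ 2 * (P.card : ℕ)) + γ₂ / 2 * ∑ b ∈ P, B b ^ 2) := by
        rw [← Real.exp_sum]
        congr 1
        simp only [mul_sub, sum_sub_distrib, sum_const, nsmul_eq_mul, mul_sum]
        ring

/-- **The letter `h222` of the capstone**: with `χ_{k,Y₀} ≤ 1` (a product of indicators) and
`χᶜ_{k,P} = Π_{b∈P} χ(r ≤ |B(b)|)` ((2.3) p. 12),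
`χ_{Y₀}(B)·χᶜ_P(B) ≤ exp(−½γ₂r²|P| + ½γ₂q_P(B))`, `q_P(B) = Σ_{b∈P}B(b)²`. [cite: Balaban1988RG2Cluster, (2.22) p.16] -/
theorem h222_of_charFns (P : Finset Λ) {r γ₂ : ℝ} (hγ : 0 ≤ γ₂) (hr : 0 ≤ r) (χY₀ χcP : (Λ → ℝ) → ℝ)
    (hχ1 : ∀ B, χY₀ B ≤ 1)
    (hχc : ∀ B, χcP B = ∏ b ∈ P, (if r ≤ |B b| then (1 : ℝ) else 0)) (B : Λ → ℝ) :
    χY₀ B * χcP B ≤ Real.exp (-(γ₂ / 2 * r ^ 2 * (P.card : ℕ)) + γ₂ / 2 * ∑ b ∈ P, B b ^ 2) := by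
  have hc0 : 0 ≤ χcP B := by rw [hχc]; exact prod_nonneg fun b _ => by split_ifs <;> norm_num
  calc χY₀ B * χcP B ≤ 1 * χcP B := mul_le_mul_of_nonneg_right (hχ1 B) hc0
    _ ≤ _ := by rw [one_mul, hχc]; exact prod_indicator_le_exp_222 P B hγ hr

/-- **The letter `hqP` of the capstone**: `Σ_{b∈P} B(b)² ≤ B⬝B` for a finite bond type. [folklore] [cite: Balaban1988RG2Cluster, (2.22) p.16] -/
theorem sum_sq_le_dotProduct [Fintype Λ] (P : Finset Λ) (B : Λ → ℝ) : ∑ b ∈ P, B b ^ 2 ≤ B ⬝ᵥ B := by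
  have h : B ⬝ᵥ B = ∑ b, B b ^ 2 := by simp only [dotProduct, pow_two]
  rw [h]
  exact sum_le_univ_sum_of_nonneg fun b => sq_nonneg _

end Ineq222

/-! ## §2. G6 on the torus: the diameter of a face-connected family of cubes at cube resolution -/

section TorusDiameter

variable {d n : ℕ} [NeZero n]

/-- One wall step `□ ↦ □ + e_i` costs at most `1` in the ℓ¹ torus distance of the cube chart
`□ ↦ ((ZMod.finEquiv n)⁻¹(□_j))_j` (the chart is additive, so the step is `up` of the site torus: `tdist1_up_le`).
[cite: Balaban1987RG1, p.257 (localization domains; common walls)] -/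
theorem tdist1_chart_update_le_one (a : TPt d n) (i : Fin d) :
    tdist1 (fun _ : Fin d => n) (UT.ofSite _ fun j => (ZMod.finEquiv n).symm (a j))
      (UT.ofSite _ fun j => (ZMod.finEquiv n).symm (Function.update a i (a i + 1) j)) ≤ 1 := by
  have key : (UT.ofSite (fun _ : Fin d => n) fun j => (ZMod.finEquiv n).symm (Function.update a i (a i + 1) j)) =
      up (UT.ofSite (fun _ : Fin d => n) fun j => (ZMod.finEquiv n).symm (a j)) i := by
    unfold up
    show (fun j => (ZMod.finEquiv n).symm (Function.update a i (a i + 1) j)) =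
      Function.update (fun j => (ZMod.finEquiv n).symm (a j)) i ((ZMod.finEquiv n).symm (a i) + 1)
    funext j
    by_cases hj : j = i
    · subst hj
      simp only [Function.update_self, map_add, map_one]
    · simp only [Function.update_of_ne hj]
  rw [key]
  exact tdist1_up_le _ i

/-- **Adjacent cubes of the torus are at chart distance ≤ 1** (a common wall, wrap-around walls included).
[cite: Balaban1987RG1, p.257 (localization domains; common walls)] -/
theorem tdist1_chart_le_one_of_tadj {a b : TPt d n} (h : TAdj a b) :
    tdist1 (fun _ : Fin d => n) (UT.ofSite _ fun j => (ZMod.finEquiv n).symm (a j))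
      (UT.ofSite _ fun j => (ZMod.finEquiv n).symm (b j)) ≤ 1 := by
  obtain ⟨i, hb | ha⟩ := h
  · rw [hb]; exact tdist1_chart_update_le_one a i
  · rw [tdist1_comm, ha]; exact tdist1_chart_update_le_one b i

/-- **G6 ON THE TORUS (cube resolution).**  In a torus-face-connected family `S` of cubes ([I] p. 257, periodic carrier
p. 251) any two cubes are at chart distance `≤ #S − 1`: the chain of cubes with consecutive common walls is a walk of the
wall graph on `S`, shortened to a path (`SimpleGraph.Walk.bypass`) it visits at most `#S` cubes, and each step costs ≤ 1
(`tdist1_chart_le_one_of_tadj`, triangle inequality `tdist1_triangle`).  Torus twin of `B13DiameterG6.l1_le_card_sub_one`.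
[cite: Balaban1987RG1, p.257 (localization domains)] -/
theorem tdist1_chart_le_card_sub_one {S : Finset (TPt d n)} (hS : TFaceConnected S) {a b : TPt d n}
    (ha : a ∈ S) (hb : b ∈ S) :
    tdist1 (fun _ : Fin d => n) (UT.ofSite _ fun j => (ZMod.finEquiv n).symm (a j))
      (UT.ofSite _ fun j => (ZMod.finEquiv n).symm (b j)) ≤ (S.card : ℝ) - 1 := by
  classical
  let G : SimpleGraph ↥S := SimpleGraph.fromRel fun x y => TAdj x.1 y.1
  let ch : TPt d n → UT (fun _ : Fin d => n) := fun a => UT.ofSite _ fun j => (ZMod.finEquiv n).symm (a j)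
  have hreach : ∀ {x y : TPt d n} (_ : TLinked S x y) (hx : x ∈ S) (hy : y ∈ S), G.Reachable ⟨x, hx⟩ ⟨y, hy⟩ := by
    intro x y hl
    induction hl with
    | refl => intro hx hy; exact SimpleGraph.Reachable.refl _
    | tail _ hbc ih =>
      intro hx hy
      refine (ih hx hbc.1).trans ?_
      by_cases heq : (⟨_, hbc.1⟩ : ↥S) = ⟨_, hy⟩
      · rw [heq]
      · exact SimpleGraph.Adj.reachable ((SimpleGraph.fromRel_adj _ _ _).2 ⟨heq, Or.inl hbc.2.2⟩)
  have hwalk : ∀ {u v : ↥S} (p : G.Walk u v), tdist1 (fun _ : Fin d => n) (ch u.1) (ch v.1) ≤ p.length := by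
    intro u v p
    induction p with
    | nil => simp [ch, tdist1_self]
    | @cons x y z hadj p ih =>
      rw [SimpleGraph.Walk.length_cons]
      push_cast
      have hxy : TAdj x.1 y.1 ∨ TAdj y.1 x.1 := ((SimpleGraph.fromRel_adj _ _ _).1 hadj).2
      have h1 : tdist1 (fun _ : Fin d => n) (ch x.1) (ch y.1) ≤ 1 := by
        rcases hxy with h | h
        · exact tdist1_chart_le_one_of_tadj h
        · rw [tdist1_comm]; exact tdist1_chart_le_one_of_tadj h
      have h2 := tdist1_triangle (N := fun _ : Fin d => n) (ch x.1) (ch y.1) (ch z.1)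
      linarith
  obtain ⟨p⟩ := hreach (hS a ha b hb) ha hb
  have hlt := p.bypass_isPath.length_lt
  rw [Fintype.card_coe] at hlt
  have h' : ((p.bypass.length : ℕ) : ℝ) + 1 ≤ (S.card : ℝ) := by exact_mod_cast hlt
  linarith [hwalk p.bypass]

/-- The cube chart is injective (so «bonds per site of the chart image» = «bonds per cube»).  Private plumbing.
[folklore] -/
private theorem chart_injective : Function.Injective
    (fun a : TPt d n => (UT.ofSite (fun _ : Fin d => n) fun j => (ZMod.finEquiv n).symm (a j))) := by
  intro a b h
  funext j
  have hj := congrFun (show (fun j => (ZMod.finEquiv n).symm (a j)) = fun j => (ZMod.finEquiv n).symm (b j) from h) j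
  exact (ZMod.finEquiv n).symm.injective hj

end TorusDiameter

/-! ## §3. (2.20) on the torus with an abstract distance reading on the bonds -/

section Rho

variable {n : ℕ} [NeZero n] {β : Type*} [Fintype β]

/-- **(2.20) ON THE TORUS, abstract distance reading** — `B13Ineq220Torus.ineq220_torus` with the bond locations replaced
by any symmetric reading `ρ` whose (2.20)-kernel row sums are `≤ C` (the first «O(1)»); the V″-sum through
`TreeLengthTorus.sum_exp_torusTreeLen_le` as there. [cite: Balaban1988RG2Cluster, (2.20) p.16] -/
theorem ineq220_torus_rho (c : B13.Consts) (hα : 0 ≤ c.α₄)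
    (hκ₁ : Real.log 162 ≤ 1 / 4 * (c.κ₁ - 1)) (hδκ : 64 * Real.log 162 ≤ c.δ * c.κ)
    (D : Finset (Finset (TPt 4 n))) (hD : ∀ Y ∈ D, Y.Nonempty ∧ TFaceConnected Y)
    (sY : Finset (TPt 4 n) → Finset β) (cube : β → TPt 4 n) (hcube : ∀ Y ∈ D, ∀ b ∈ sY Y, cube b ∈ Y)
    (ρ : β → β → ℝ) (hρsymm : ∀ b b', ρ b b' = ρ b' b) {C : ℝ} (hrow : ∀ b, ∑ b', ker220 c (ρ b b') ≤ C)
    (θ : β → ℝ) (hθ : ∀ b, 0 ≤ θ b) (q : Finset (TPt 4 n) → β → β → ℝ)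
    (hq : ∀ Y ∈ D, ∀ b ∈ sY Y, ∀ b' ∈ sY Y, q Y b b' ≤ elem219 c Y.card (ρ b b'))
    (v : Finset (TPt 4 n) → ℝ) (hv : ∀ Y ∈ D, v Y ≤ vpp220 c (torusTreeLen Y)) :
    ∑ Y ∈ D, (1 / 2 * ∑ b ∈ sY Y, ∑ b' ∈ sY Y, q Y b b' * (θ b * θ b') + v Y)
      ≤ 1 / 2 * C * ∑ b, θ b ^ 2 + K₀ 64 8 * c.α₄ * (D.biUnion id).card := by
  classical
  have ha₀ : a₀ (2 * 4) ≤ 1 / 4 * (c.κ₁ - 1) := by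
    rwa [show a₀ (2 * 4) = Real.log 162 by norm_num [a₀]]
  have hk : kappa₀ (4 * 2 ^ 4) (2 * 4) ≤ c.δ * c.κ := by rwa [TreeLengthCubeSystem.kappa₀_four]
  have hK : K₀ (4 * 2 ^ 4) (2 * 4) = K₀ 64 8 := by norm_num
  rw [← hK]
  refine ineq220 (R := TAdj) (nbr := tnbr) (Δ := 2 * 4) (β := β) (fun x y h => h.symm) (tdegreeLE 4 n)
    (fun x y h => mem_tnbr.2 h) c hα ha₀ D (fun Y hY => isRConnected_of_tFaceConnected (hD Y hY).1 (hD Y hY).2)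
    univ sY (fun Y _ => subset_univ _) cube hcube ρ (fun b _ b' _ => hρsymm b b') (fun b _ => hrow b) θ
    (fun b _ => hθ b) q hq torusTreeLen v hv fun x _ => ?_
  simp_rw [show ∀ Y : Finset (TPt 4 n), -(c.δ * c.κ * torusTreeLen Y) = -(c.δ * c.κ) * torusTreeLen Y from
    fun Y => by rw [neg_mul]]
  calc ∑ Y ∈ D with x ∈ Y, Real.exp (-(c.δ * c.κ) * torusTreeLen Y)
      ≤ ∑ X ∈ (univ : Finset (Finset (TPt 4 n))).filter (fun X => x ∈ X ∧ TFaceConnected X),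
          Real.exp (-(c.δ * c.κ) * torusTreeLen X) :=
        sum_le_sum_of_subset_of_nonneg (fun Y hY => mem_filter.2
          ⟨mem_univ _, (mem_filter.1 hY).2, (hD Y (mem_filter.1 hY).1).2⟩) fun X _ _ => (Real.exp_pos _).le
    _ ≤ K₀ (4 * 2 ^ 4) (2 * 4) := sum_exp_torusTreeLen_le 4 n x hk

end Rho

section Bridge

variable {L N' : ℕ} [NeZero L] [NeZero N'] {Λ : Type*} [Fintype Λ]

/-- **(2.18)–(2.20) ON THE TWO-SCALE TORUS FROM LEMMA 2, abstract distance reading** — the statement of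
`B13Ineq220Torus.sum_tau_norm_V_le_of_lemma2` with the bond sites replaced by a symmetric reading `ρ` on the bonds of Z₀
whose (2.20)-kernel row sums are `≤ C` and which obeys G6 relative to every `Y ∈ 𝐃` (`ρ(b, b′) ≤ 4M·M⁻⁴|Y|` for
b, b′ ⊂ Y): `Σ_{Y∈𝐃} |τ(Y)|·‖V Y B‖ ≤ ½·C·(B⬝B) + K₀(64, 8)·α₄·#(⋃𝐃)` for every `B` small on 𝐃.
[cite: Balaban1988RG2Cluster, (2.18)–(2.20) p.16] -/
theorem sum_tau_norm_V_le_of_lemma2_rho (W : TwoTorusStep 4 L N') (c : B13.Consts)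
    (hrepr : B13.Repr142 W.toStepData) (h143 : B13.Bound143 W.toStepData c)
    (h136 : B13.Bound136 W.toStepData c W.Vpp) (hvolk : ∀ Y, W.volk Y = Y.1.card)
    (h12 : R12 c) (hC₃ : 0 ≤ c.C₃) (hE : 0 < c.E₀) (hε : 0 < c.ε₁) (hC₁ : 0 < c.C₁) (hα : 0 < c.α₄)
    (hM : 1 ≤ c.M) (hκ₁ : 1 + 4 * Real.log 162 ≤ c.κ₁) (hδκ : 64 * Real.log 162 ≤ c.δ * c.κ)
    (Dfam : Finset (TDom 4 (L * N'))) (ι : Λ → W.Bond) (hι : Function.Injective ι)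
    (cube : W.Bond → TPt 4 (L * N'))
    (hQsupp : ∀ (Y : TDom 4 (L * N')) φ b b', W.Q Y φ b b' ≠ 0 → cube b ∈ Y.1 ∧ cube b' ∈ Y.1)
    (ρ : Λ → Λ → ℝ) (hρsymm : ∀ b b', ρ b b' = ρ b' b) {C : ℝ} (hrow : ∀ b, ∑ b', ker220 c (ρ b b') ≤ C)
    (hG6 : ∀ Y ∈ Dfam, ∀ b b' : Λ, cube (ι b) ∈ Y.1 → cube (ι b') ∈ Y.1 → ρ b b' ≤ 4 * c.M * (Y.1.card : ℝ))
    (emb : (Λ → ℝ) → W.Φ) (hBv : ∀ B b, W.Bv (emb B) (ι b) = (B b : ℂ))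
    (hBv0 : ∀ B b', b' ∉ Set.range ι → W.Bv (emb B) b' = 0)
    (V : TDom 4 (L * N') → (Λ → ℝ) → ℂ)
    (hV : ∀ Y ∈ Dfam, ∀ B, emb B ∈ W.sp1 Y → V Y B = W.V Y (emb B))
    (B : Λ → ℝ) (hsmall : ∀ Y ∈ Dfam, emb B ∈ W.sp1 Y) :
    ∑ Y ∈ Dfam, (invTau c ((tsys 4 (L * N')).dj Y))⁻¹ * ‖V Y B‖ ≤
      1 / 2 * C * (B ⬝ᵥ B) + K₀ 64 8 * c.α₄ * (((Dfam.image Subtype.val).biUnion id).card : ℝ) := by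
  classical
  have hκ₁' : 1 < c.κ₁ := by linarith [Real.log_pos (show (1 : ℝ) < 162 by norm_num)]
  have hM0 : 0 < c.M := by linarith
  set φ : W.Φ := emb B with hφdef
  set sY : Finset (TPt 4 (L * N')) → Finset Λ := fun X => univ.filter fun b => cube (ι b) ∈ X with hsY
  set q : Finset (TPt 4 (L * N')) → Λ → Λ → ℝ := fun X b b' =>
    if hX : IsTDom X then (invTau c (torusTreeLen X))⁻¹ * ‖W.Q ⟨X, hX⟩ φ (ι b) (ι b')‖ else 0 with hq
  set v : Finset (TPt 4 (L * N')) → ℝ := fun X =>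
    if hX : IsTDom X then (invTau c (torusTreeLen X))⁻¹ * ‖W.Vpp ⟨X, hX⟩ φ‖ else 0 with hv
  have hτ0 : ∀ Y : TDom 4 (L * N'), 0 ≤ (invTau c ((tsys 4 (L * N')).dj Y))⁻¹ :=
    fun Y => (inv_pos.2 (invTau_pos c hE hε hC₁ hα hM0 _)).le
  have hperY : ∀ Y ∈ Dfam, (invTau c ((tsys 4 (L * N')).dj Y))⁻¹ * ‖V Y B‖ ≤
      1 / 2 * ∑ b ∈ sY Y.1, ∑ b' ∈ sY Y.1, q Y.1 b b' * (|B b| * |B b'|) + v Y.1 := by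
    intro Y hY
    have hφ : φ ∈ W.sp1 Y := hsmall Y hY
    have hrep : W.V Y φ = W.toStepData.quadForm Y φ + W.Vpp Y φ := hrepr Y φ hφ
    rw [hV Y hY B hφ, ← hφdef, hrep]
    have hqf := norm_quadForm_le_sum_bonds W.toStepData Y φ ι hι B (hBv B) (hBv0 B)
      (fun b => cube b ∈ Y.1) (fun b b' h => hQsupp Y φ b b' h)
    have hY2 : IsTDom Y.1 := Y.2
    have hqY : ∀ b b', q Y.1 b b' = (invTau c (torusTreeLen Y.1))⁻¹ * ‖W.Q Y φ (ι b) (ι b')‖ := fun b b' => by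
      simp only [hq, dif_pos hY2, Subtype.coe_eta]
    have hvY : v Y.1 = (invTau c (torusTreeLen Y.1))⁻¹ * ‖W.Vpp Y φ‖ := by
      simp only [hv, dif_pos hY2, Subtype.coe_eta]
    calc (invTau c ((tsys 4 (L * N')).dj Y))⁻¹ * ‖W.toStepData.quadForm Y φ + W.Vpp Y φ‖
        ≤ (invTau c ((tsys 4 (L * N')).dj Y))⁻¹ * (‖W.toStepData.quadForm Y φ‖ + ‖W.Vpp Y φ‖) :=
          mul_le_mul_of_nonneg_left (norm_add_le _ _) (hτ0 Y)
      _ ≤ (invTau c ((tsys 4 (L * N')).dj Y))⁻¹ *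
            (1 / 2 * ∑ b ∈ sY Y.1, ∑ b' ∈ sY Y.1, ‖W.Q Y φ (ι b) (ι b')‖ * (|B b| * |B b'|) + ‖W.Vpp Y φ‖) :=
          mul_le_mul_of_nonneg_left (add_le_add hqf le_rfl) (hτ0 Y)
      _ = 1 / 2 * ∑ b ∈ sY Y.1, ∑ b' ∈ sY Y.1, q Y.1 b b' * (|B b| * |B b'|) + v Y.1 := by
          simp only [hqY, hvY, tsys_dj, mul_add, mul_sum]
          congr 1
          refine sum_congr rfl fun b _ => sum_congr rfl fun b' _ => ?_
          ring
  have hD : ∀ X ∈ Dfam.image Subtype.val, X.Nonempty ∧ TFaceConnected X := fun X hX => by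
    obtain ⟨Y, -, rfl⟩ := mem_image.1 hX; exact Y.2
  have hqle : ∀ X ∈ Dfam.image Subtype.val, ∀ b ∈ sY X, ∀ b' ∈ sY X,
      q X b b' ≤ elem219 c X.card (ρ b b') := by
    intro X hX b hb b' hb'
    obtain ⟨Y, hY, rfl⟩ := mem_image.1 hX
    have hb1 : cube (ι b) ∈ Y.1 := (mem_filter.1 hb).2
    have hb2 : cube (ι b') ∈ Y.1 := (mem_filter.1 hb').2
    simp only [hq, dif_pos Y.2, Subtype.coe_eta]
    have hvolk' : ((W.toStepData.volk Y : ℕ) : ℝ) = (Y.1.card : ℝ) := by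
      show ((W.volk Y : ℕ) : ℝ) = _; rw [hvolk Y]
    have hG6' : ρ b b' ≤ 4 * c.M * ((W.toStepData.volk Y : ℕ) : ℝ) := by
      rw [hvolk']; exact hG6 Y hY b b' hb1 hb2
    have h := elem219_of_bound143 W.toStepData c h143 h12 hC₃ hE hε hC₁ hα hM hκ₁'.le Y φ (ι b) (ι b')
      (hsmall Y hY) hG6'
    rwa [hvolk'] at h
  have hvle : ∀ X ∈ Dfam.image Subtype.val, v X ≤ vpp220 c (torusTreeLen X) := fun X hX => by
    obtain ⟨Y, hY, rfl⟩ := mem_image.1 hX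
    simp only [hv, dif_pos Y.2]
    exact vpp_of_bound136 W.toStepData c h136 hE hε hC₁ hα hM0 Y φ (hsmall Y hY)
  have h220 := ineq220_torus_rho c hα.le (by linarith) hδκ (Dfam.image Subtype.val) hD sY (fun b => cube (ι b))
    (fun X _ b hb => (mem_filter.1 hb).2) ρ hρsymm hrow (fun b => |B b|) (fun b => abs_nonneg _) q hqle v hvle
  have hsumD : ∑ Y ∈ Dfam, (invTau c ((tsys 4 (L * N')).dj Y))⁻¹ * ‖V Y B‖ ≤
      ∑ X ∈ Dfam.image Subtype.val, (1 / 2 * ∑ b ∈ sY X, ∑ b' ∈ sY X, q X b b' * (|B b| * |B b'|) + v X) := by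
    rw [sum_image fun Y _ Y' _ h => Subtype.ext h]
    exact sum_le_sum hperY
  have hθ2 : ∑ b, |B b| ^ 2 = B ⬝ᵥ B := by simp only [dotProduct, pow_two, abs_mul_abs_self]
  refine hsumD.trans (h220.trans (le_of_eq ?_))
  rw [hθ2]

end Bridge

/-! ## §4. (2.18)–(2.20) on the torus with the bonds located at their cubes: G6 discharged -/

section Cubes

variable {L N' : ℕ} [NeZero L] [NeZero N'] {Λ : Type*} [Fintype Λ]

/-- The (2.20)-kernel at the cube-scaled reading: `ker220(M·t) = α₄M⁻⁴e^{−(κ₁−1)/16·t}` (`M ≠ 0`).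
[cite: Balaban1988RG2Cluster, (2.20) p.16] -/
theorem ker220_mul (c : B13.Consts) (hM : c.M ≠ 0) (t : ℝ) :
    ker220 c (c.M * t) = c.α₄ * (c.M ^ 4)⁻¹ * Real.exp (-((c.κ₁ - 1) / 16 * t)) := by
  rw [ker220_eq]
  congr 2
  field_simp

/-- **The row sum of the (2.20)-kernel for bonds located AT THEIR CUBES** with the cube-scaled reading
`ρ(b, b′) = M·d₁(chart □(b), chart □(b′))`: at most `m` bonds per cube, `κ₁ > 1`, `M > 0`, `α₄ ≥ 0` ⇒
`Σ_{b′} ker220(ρ(b, b′)) ≤ m·α₄·M⁻⁴·(1 + 32/(κ₁−1))⁴` — the torus lattice constant at the M-INDEPENDENT rate `(κ₁−1)/16`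
(`kc_tdist1`, grouped by cubes through the injective chart). [cite: Balaban1988RG2Cluster, (2.20) p.16] -/
theorem rowSum_ker220_cubes_le (c : B13.Consts) (hα : 0 ≤ c.α₄) (hκ₁ : 1 < c.κ₁) (hM : 0 < c.M)
    (cubeΛ : Λ → TPt 4 (L * N')) {m : ℕ} (hfib : ∀ a : TPt 4 (L * N'), (univ.filter fun j => cubeΛ j = a).card ≤ m)
    (b : Λ) :
    ∑ b', ker220 c (c.M * tdist1 (fun _ : Fin 4 => L * N')
        (UT.ofSite _ fun j => (ZMod.finEquiv (L * N')).symm (cubeΛ b j))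
        (UT.ofSite _ fun j => (ZMod.finEquiv (L * N')).symm (cubeΛ b' j))) ≤
      m * c.α₄ * (c.M ^ 4)⁻¹ * (1 + 32 / (c.κ₁ - 1)) ^ 4 := by
  classical
  have hk1 : 0 < c.κ₁ - 1 := by linarith
  have hrate : 0 < (c.κ₁ - 1) / 16 := by positivity
  set loc : Λ → UT (fun _ : Fin 4 => L * N') :=
    fun j => UT.ofSite _ fun i => (ZMod.finEquiv (L * N')).symm (cubeΛ j i) with hloc
  -- at most `m` bonds per chart site (the chart is injective)
  have hfib' : ∀ x : UT (fun _ : Fin 4 => L * N'), (univ.filter fun j => loc j = x).card ≤ m := by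
    intro x
    by_cases hx : (univ.filter fun j => loc j = x).Nonempty
    · obtain ⟨j₀, hj₀⟩ := hx
      have hx0 : loc j₀ = x := (mem_filter.1 hj₀).2
      refine (card_le_card ?_).trans (hfib (cubeΛ j₀))
      intro j hj
      have hjx : loc j = x := (mem_filter.1 hj).2
      refine mem_filter.2 ⟨mem_univ _, chart_injective ?_⟩
      show (UT.ofSite (fun _ : Fin 4 => L * N') fun i => (ZMod.finEquiv (L * N')).symm (cubeΛ j i)) =
        UT.ofSite (fun _ : Fin 4 => L * N') fun i => (ZMod.finEquiv (L * N')).symm (cubeΛ j₀ i)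
      exact hjx.trans hx0.symm
    · rw [not_nonempty_iff_eq_empty.1 hx, card_empty]; exact Nat.zero_le _
  have hsum := sum_exp_neg_loc_le_pt (ρ := tdist1 (fun _ : Fin 4 => L * N')) (Kc := fun b : ℝ => (1 + 2 / b) ^ 4)
    kc_tdist1 hrate loc hfib' (loc b)
  have e32 : (1 + 2 / ((c.κ₁ - 1) / 16)) = 1 + 32 / (c.κ₁ - 1) := by
    field_simp; ring
  calc ∑ b', ker220 c (c.M * tdist1 (fun _ : Fin 4 => L * N') (loc b) (loc b'))
      = c.α₄ * (c.M ^ 4)⁻¹ * ∑ b', Real.exp (-((c.κ₁ - 1) / 16 * tdist1 (fun _ : Fin 4 => L * N') (loc b) (loc b'))) := by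
        rw [mul_sum]; exact sum_congr rfl fun b' _ => ker220_mul c hM.ne' _
    _ ≤ c.α₄ * (c.M ^ 4)⁻¹ * (m * (1 + 2 / ((c.κ₁ - 1) / 16)) ^ 4) := mul_le_mul_of_nonneg_left hsum (by positivity)
    _ = m * c.α₄ * (c.M ^ 4)⁻¹ * (1 + 32 / (c.κ₁ - 1)) ^ 4 := by rw [e32]; ring

/-- **(2.18)–(2.20) ON THE TWO-SCALE TORUS FROM LEMMA 2, BONDS LOCATED AT THEIR CUBES — G6 DISCHARGED.**  As
`B13Ineq220Torus.sum_tau_norm_V_le_of_lemma2` (Lemma 2's (1.42)/(1.43)/(1.36)-for-V″ of the record's torus step, `volk = #Y`,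
R12, κ₁ ≥ 1 + 4 log 162, δκ ≥ 64 log 162, M ≥ 1, E₀, ε₁, C₁, α₄ > 0, C₃ ≥ 0; the term's family 𝐃, bonds `Λ` of Z₀ injected
by `ι`, the cube map with the support of `Q(Y, ·, b, b′)` on b, b′ ⊂ Y, at most `m` bonds of Z₀ per cube, the embedding
`emb` of the real field and the potentials `V` agreeing with the record on (1.34)), WITHOUT a site torus and WITHOUT a G6
hypothesis: the reading `ρ(b, b′) = M·d₁(chart □(b), chart □(b′)) ≤ M(#Y − 1) ≤ 4M·M⁻⁴|Y|` (§2) is admissible in (2.19).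
CONCLUSION, for every `B` small on 𝐃: `Σ_{Y∈𝐃} |τ(Y)|·‖V Y B‖ ≤ ½·(m·α₄·M⁻⁴(1 + 32/(κ₁−1))⁴)·(B⬝B) + K₀(64, 8)·α₄·#(⋃𝐃)`.
[cite: Balaban1988RG2Cluster, (2.18)–(2.20) p.16] -/
theorem sum_tau_norm_V_le_of_lemma2_cubes (W : TwoTorusStep 4 L N') (c : B13.Consts)
    (hrepr : B13.Repr142 W.toStepData) (h143 : B13.Bound143 W.toStepData c)
    (h136 : B13.Bound136 W.toStepData c W.Vpp) (hvolk : ∀ Y, W.volk Y = Y.1.card)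
    (h12 : R12 c) (hC₃ : 0 ≤ c.C₃) (hE : 0 < c.E₀) (hε : 0 < c.ε₁) (hC₁ : 0 < c.C₁) (hα : 0 < c.α₄)
    (hM : 1 ≤ c.M) (hκ₁ : 1 + 4 * Real.log 162 ≤ c.κ₁) (hδκ : 64 * Real.log 162 ≤ c.δ * c.κ)
    (Dfam : Finset (TDom 4 (L * N'))) (ι : Λ → W.Bond) (hι : Function.Injective ι)
    (cube : W.Bond → TPt 4 (L * N'))
    (hQsupp : ∀ (Y : TDom 4 (L * N')) φ b b', W.Q Y φ b b' ≠ 0 → cube b ∈ Y.1 ∧ cube b' ∈ Y.1)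
    {m : ℕ} (hfib : ∀ a : TPt 4 (L * N'), (univ.filter fun j => cube (ι j) = a).card ≤ m)
    (emb : (Λ → ℝ) → W.Φ) (hBv : ∀ B b, W.Bv (emb B) (ι b) = (B b : ℂ))
    (hBv0 : ∀ B b', b' ∉ Set.range ι → W.Bv (emb B) b' = 0)
    (V : TDom 4 (L * N') → (Λ → ℝ) → ℂ)
    (hV : ∀ Y ∈ Dfam, ∀ B, emb B ∈ W.sp1 Y → V Y B = W.V Y (emb B))
    (B : Λ → ℝ) (hsmall : ∀ Y ∈ Dfam, emb B ∈ W.sp1 Y) :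
    ∑ Y ∈ Dfam, (invTau c ((tsys 4 (L * N')).dj Y))⁻¹ * ‖V Y B‖ ≤
      1 / 2 * (m * c.α₄ * (c.M ^ 4)⁻¹ * (1 + 32 / (c.κ₁ - 1)) ^ 4) * (B ⬝ᵥ B) +
        K₀ 64 8 * c.α₄ * (((Dfam.image Subtype.val).biUnion id).card : ℝ) := by
  have hκ₁' : 1 < c.κ₁ := by linarith [Real.log_pos (show (1 : ℝ) < 162 by norm_num)]
  have hM0 : 0 < c.M := by linarith
  refine sum_tau_norm_V_le_of_lemma2_rho W c hrepr h143 h136 hvolk h12 hC₃ hE hε hC₁ hα hM hκ₁ hδκ Dfam ι hι cube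
    hQsupp (fun b b' => c.M * tdist1 (fun _ : Fin 4 => L * N')
      (UT.ofSite _ fun j => (ZMod.finEquiv (L * N')).symm (cube (ι b) j))
      (UT.ofSite _ fun j => (ZMod.finEquiv (L * N')).symm (cube (ι b') j)))
    (fun b b' => by rw [tdist1_comm]) (rowSum_ker220_cubes_le c hα.le hκ₁' hM0 (fun j => cube (ι j)) hfib)
    (fun Y hY b b' hb hb' => ?_) emb hBv hBv0 V hV B hsmall
  -- G6 discharged: M·d₁(chart □, chart □′) ≤ M·(#Y − 1) ≤ 4M·#Y
  have hdiam := tdist1_chart_le_card_sub_one Y.2.2 hb hb'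
  have hcard : (1 : ℝ) ≤ (Y.1.card : ℝ) := by exact_mod_cast Finset.card_pos.2 Y.2.1
  calc c.M * tdist1 (fun _ : Fin 4 => L * N') (UT.ofSite _ fun j => (ZMod.finEquiv (L * N')).symm (cube (ι b) j))
        (UT.ofSite _ fun j => (ZMod.finEquiv (L * N')).symm (cube (ι b') j))
      ≤ c.M * ((Y.1.card : ℝ) - 1) := mul_le_mul_of_nonneg_left hdiam hM0.le
    _ ≤ 4 * c.M * (Y.1.card : ℝ) := by nlinarith

/-- **The «O(1)» of (2.20) is ABSOLUTE for the record's bond layer**: with at most `4M⁴` bonds of the unit torus per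
M-cube (d = 4: `d·M^d` initial points × directions), `m ≤ 4M⁴` turns the constant of
`sum_tau_norm_V_le_of_lemma2_cubes` into `½·(4α₄(1 + 32/(κ₁−1))⁴)·(B⬝B)` — print: *"this yields a constant O(1). In fact the
constant is small for κ₁ large"*. [cite: Balaban1988RG2Cluster, (2.20) p.16] -/
theorem rowConst_cubes_abs (c : B13.Consts) (hM : 0 < c.M) (hα : 0 ≤ c.α₄) {m : ℕ} (hm : (m : ℝ) ≤ 4 * c.M ^ 4) :
    m * c.α₄ * (c.M ^ 4)⁻¹ * (1 + 32 / (c.κ₁ - 1)) ^ 4 ≤ 4 * c.α₄ * (1 + 32 / (c.κ₁ - 1)) ^ 4 := by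
  have hM4 : 0 < c.M ^ 4 := by positivity
  have h1 : (m : ℝ) * (c.M ^ 4)⁻¹ ≤ 4 := by
    rw [← div_eq_mul_inv, div_le_iff₀ hM4]; exact hm
  have h2 : 0 ≤ c.α₄ * (1 + 32 / (c.κ₁ - 1)) ^ 4 := by positivity
  calc m * c.α₄ * (c.M ^ 4)⁻¹ * (1 + 32 / (c.κ₁ - 1)) ^ 4
      = (m * (c.M ^ 4)⁻¹) * (c.α₄ * (1 + 32 / (c.κ₁ - 1)) ^ 4) := by ring
    _ ≤ 4 * (c.α₄ * (1 + 32 / (c.κ₁ - 1)) ^ 4) := mul_le_mul_of_nonneg_right h1 h2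
    _ = 4 * c.α₄ * (1 + 32 / (c.κ₁ - 1)) ^ 4 := by ring

end Cubes

/-! ## §5. The torus (2.26) capstone with its Lemma-2 binders discharged -/

section Joiner

variable {L N' : ℕ} [NeZero L] [NeZero N'] {M : ℕ}
variable {ν : ℕ} {Nf : Fin ν → ℕ} [∀ i, NeZero (Nf i)]
variable {Λ : Type} [Fintype Λ] [DecidableEq Λ] {C₀ : Type} [Fintype C₀] [DecidableEq C₀]

open Matrix
open Literature.MathematicalPhysics.QuantumFieldTheory.Balaban1983to89.B13Term214 (term214 SepHolOn core214 F214)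
open Literature.MathematicalPhysics.QuantumFieldTheory.Balaban1983to89.B13Lemma3TorusData (TBond)
open Literature.MathematicalPhysics.QuantumFieldTheory.Balaban1983to89.B13Lemma3TorusTerms (weight Z0)
open Literature.MathematicalPhysics.QuantumFieldTheory.Balaban1983to89.TreeLengthTorusTransfer (tclosure)
open Literature.MathematicalPhysics.QuantumFieldTheory.Balaban1983to89.B13Lemma3TorusPrimitive
  (h226_torus_of_primitives)
open Literature.MathematicalPhysics.QuantumFieldTheory.Balaban1983to89.B13Ineq220Torus
  (h220R_of_small F214_congr_of_small)

open Classical in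
/-- **(2.26) FOR ONE TERM OF THE TORUS MODEL FROM THE PRIMITIVE OBJECTS AND LEMMA 2 OF THE RECORD** —
`B13Lemma3TorusPrimitive.h226_torus_of_primitives` (d = 4) with its by-assertion Lemma-2 binders `h222`, `hqP`, `h220R`,
`ha0` (and the non-negativity of `χᶜ_P`) DISCHARGED: (2.22) from the product structure of the (2.3) characteristic
functions (`h222_of_charFns`: `χ_{k,Y₀} ∈ [0, 1]`, `χᶜ_{k,P} = Π_{b∈P} χ(r_P ≤ |B(b)|)`, `|P| = #P`), and (2.18)–(2.20) from
(1.42)/(1.43)/(1.36)-for-V″ of the torus step `W` (`sum_tau_norm_V_le_of_lemma2_cubes`: bonds of Z₀ located at their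
cubes, ≤ m′ per cube, G6 discharged) through the small-field truncation, which the characteristic function `χ_{k,Y₀}`
makes invisible (`hχsupp`: `χ_{Y₀}(B) ≠ 0` ⇒ the configuration `emb B` lies in the space (1.34) of every `Y ∈ 𝐃`).  The
printed constants: `a₂₀ = m′·α₄·M⁻⁴(1 + 32/(κ₁−1))⁴`, `w = K₀(64, 8)·α₄·#(⋃𝐃)` enter the smallness and volume
conditions literally.  Every other binder is the capstone's (primitive kernels L17a/L16a = NODE O objects, separate
analyticity, norms, numbers, constant matching). [cite: Balaban1988RG2Cluster, (2.14)–(2.26) pp.15–17, Lemma 2 p.11] -/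
theorem h226_torus_of_primitives_of_lemma2 (c : B13.Consts) (hκ₁1 : 1 ≤ c.κ₁) (hα₆ : c.α₆ ≠ 0)
    -- Lemma 2 of the record at the torus step, and the numbers of (2.18)–(2.20)
    (W : TwoTorusStep 4 L N') (hrepr : B13.Repr142 W.toStepData) (h143 : B13.Bound143 W.toStepData c)
    (h136 : B13.Bound136 W.toStepData c W.Vpp) (hvolk : ∀ Y, W.volk Y = Y.1.card)
    (h12 : R12 c) (hC₃ : 0 ≤ c.C₃) (hE : 0 < c.E₀) (hε : 0 < c.ε₁) (hC₁ : 0 < c.C₁) (hα : 0 < c.α₄)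
    (hM : 1 ≤ c.M) (hκ₁ : 1 + 4 * Real.log 162 ≤ c.κ₁) (hδκ : 64 * Real.log 162 ≤ c.δ * c.κ)
    (Z : TDom 4 N') (t : Finset (TDom 4 (L * N')) × Finset (TBond 4 M (L * N')))
    (hpos : ∀ Y : TDom 4 (L * N'), 0 < invTau c ((tsys 4 (L * N')).dj Y))
    (hhalf : ∀ Y : TDom 4 (L * N'), invTau c ((tsys 4 (L * N')).dj Y) ≤ 1 / 2)
    {Uσ Uτ : Set ℂ} (hUσ : IsOpen Uσ) (hUτ : IsOpen Uτ) (hUexp : Metric.closedBall (0 : ℂ) (Real.exp c.κ₁) ⊆ Uσ)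
    (hUtau : ∀ Y : TDom 4 (L * N'), Metric.closedBall (0 : ℂ) ((invTau c ((tsys 4 (L * N')).dj Y))⁻¹) ⊆ Uτ)
    {r : ℝ} (hr : 0 < r) (hr' : r ≤ Real.exp c.κ₁ - 1)
    (hsubτ : ∀ s ∈ Set.uIcc (0 : ℝ) 1, Metric.closedBall (s : ℂ) r ⊆ Uτ)
    (lZ : List (TPt 4 N')) (hlZ : lZ.Nodup ∧ lZ.toFinset = Z.1 \ tclosure L N' (Z0 M t))
    (lD : List (TDom 4 (L * N'))) (hlD : lD.Nodup ∧ lD.toFinset = t.1)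
    (A : (TPt 4 N' → ℂ) → Matrix Λ Λ ℂ) (Γ : (TPt 4 N' → ℂ) → (Λ ⊕ C₀ → ℝ) → (Λ → ℂ))
    -- the (2.3) characteristic functions: χ_{Y₀} ∈ [0,1] supported on the small fields, χᶜ_P = Π indicators
    (χY₀ χcP : (Λ → ℝ) → ℝ) (hχ0 : ∀ B, 0 ≤ χY₀ B) (hχ1 : ∀ B, χY₀ B ≤ 1)
    (P : Finset Λ) (hPcard : P.card = t.2.card) {rP : ℝ} (hrP : 0 ≤ rP)
    (hχc : ∀ B, χcP B = ∏ b ∈ P, (if rP ≤ |B b| then (1 : ℝ) else 0))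
    (Dfam : Finset (TDom 4 (L * N'))) (V : TDom 4 (L * N') → (Λ → ℝ) → ℂ)
    -- the record's objects behind the term: bonds, cubes, the real field inside the configurations, the potentials
    (ι : Λ → W.Bond) (hι : Function.Injective ι) (cube : W.Bond → TPt 4 (L * N'))
    (hQsupp : ∀ (Y : TDom 4 (L * N')) φ b b', W.Q Y φ b b' ≠ 0 → cube b ∈ Y.1 ∧ cube b' ∈ Y.1)
    {m' : ℕ} (hfibc : ∀ a : TPt 4 (L * N'), (univ.filter fun j => cube (ι j) = a).card ≤ m')
    (emb : (Λ → ℝ) → W.Φ) (hBv : ∀ B b, W.Bv (emb B) (ι b) = (B b : ℂ))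
    (hBv0 : ∀ B b', b' ∉ Set.range ι → W.Bv (emb B) b' = 0)
    (hV : ∀ Y ∈ Dfam, ∀ B, emb B ∈ W.sp1 Y → V Y B = W.V Y (emb B))
    (hχsupp : ∀ B, χY₀ B ≠ 0 → ∀ Y ∈ Dfam, emb B ∈ W.sp1 Y)
    -- separate analyticity of the X-integral (as in the capstone)
    (hΨσ : ∀ τ : TDom 4 (L * N') → ℂ, (∀ j, τ j ∈ Uτ) →
      SepHolOn Uσ (fun σ => core214 A Γ (F214 t.2.card χY₀ χcP Dfam V) σ τ))
    (hΨτ : ∀ σ : TPt 4 N' → ℂ, (∀ j, σ j ∈ Uσ) →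
      SepHolOn Uτ (fun τ => core214 A Γ (F214 t.2.card χY₀ χcP Dfam V) σ τ))
    {C : Matrix Λ Λ ℝ} (hC : C.PosDef) (Γ₀ : Matrix Λ (Λ ⊕ C₀) ℝ)
    (hAs : ∀ σ : TPt 4 N' → ℂ, (∀ j, ‖σ j‖ ≤ Real.exp c.κ₁) → (A σ).IsSymm)
    (hA : ∀ σ : TPt 4 N' → ℂ, (∀ j, ‖σ j‖ ≤ Real.exp c.κ₁) → ((A σ).map Complex.re).PosDef)
    (G : (TPt 4 N' → ℂ) → Matrix Λ (Λ ⊕ C₀) ℂ)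
    (hlin : ∀ σ : TPt 4 N' → ℂ, (∀ j, ‖σ j‖ ≤ Real.exp c.κ₁) →
      ∀ X : Λ ⊕ C₀ → ℝ, Γ σ X = G σ *ᵥ fun j => (X j : ℂ))
    {γ₂ : ℝ} (hγ₂ : 0 ≤ γ₂)
    -- bonds located on the torus `UT Nf` (for the kernel letters)
    (locΛ : Λ → UT Nf) (locN : Λ ⊕ C₀ → UT Nf) {m : ℕ}
    (hfibΛ : ∀ x : UT Nf, (Finset.univ.filter fun i => locΛ i = x).card ≤ m)
    (hfibN : ∀ x : UT Nf, (Finset.univ.filter fun j => locN j = x).card ≤ m)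
    -- rates and constants
    {kap kap' kap'' θ θE θΓ θC KG KΓ KCs K₀' : ℝ} (hkap'' : 0 < kap'') (h1 : kap'' < kap') (h2 : kap' < kap)
    (hθE : 0 ≤ θE) (hθΓ : 0 ≤ θΓ) (hθC : 0 ≤ θC) (hKG : 0 ≤ KG) (hKΓ : 0 ≤ KΓ) (hKCs : 0 ≤ KCs) (hK₀ : 0 ≤ K₀')
    (hθEle : θE ≤ θ) (hθΓle : θΓ ≤ θ)
    (hθR1le : (m * (1 + 2 / (kap - kap')) ^ ν) * (m * (1 + 2 / (kap' - kap'')) ^ ν)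
      * (θΓ * KCs * KG + KΓ * θC * KG + KΓ * K₀' * θΓ) ≤ θ)
    -- uniform localisation of the primitive kernels in the torus distance (L17a)
    (hG : ∀ σ : TPt 4 N' → ℂ, (∀ j, ‖σ j‖ ≤ Real.exp c.κ₁) →
      ∀ b j, ‖G σ b j‖ ≤ KG * Real.exp (-(kap * tdist1 Nf (locΛ b) (locN j))))
    (hΓ₀ : ∀ b j, ‖Γ₀ b j‖ ≤ KΓ * Real.exp (-(kap * tdist1 Nf (locΛ b) (locN j))))
    (hCs : ∀ σ : TPt 4 N' → ℂ, (∀ j, ‖σ j‖ ≤ Real.exp c.κ₁) →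
      ∀ b b', ‖(A σ)⁻¹ b b'‖ ≤ KCs * Real.exp (-(kap * tdist1 Nf (locΛ b) (locΛ b'))))
    (hC216 : ∀ b b', ‖C b b'‖ ≤ K₀' * Real.exp (-(kap * tdist1 Nf (locΛ b) (locΛ b'))))
    -- the (2.16)-type differences of the primitive kernels in the torus distance (L16a)
    (hdΓ : ∀ σ : TPt 4 N' → ℂ, (∀ j, ‖σ j‖ ≤ Real.exp c.κ₁) →
      ∀ b j, ‖(G σ - Γ₀.map (algebraMap ℝ ℂ)) b j‖ ≤ θΓ * Real.exp (-(kap * tdist1 Nf (locΛ b) (locN j))))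
    (hdC : ∀ σ : TPt 4 N' → ℂ, (∀ j, ‖σ j‖ ≤ Real.exp c.κ₁) →
      ∀ b b', ‖((A σ)⁻¹ - C.map (algebraMap ℝ ℂ)) b b'‖
        ≤ θC * Real.exp (-(kap * tdist1 Nf (locΛ b) (locΛ b'))))
    (hdE : ∀ σ : TPt 4 N' → ℂ, (∀ j, ‖σ j‖ ≤ Real.exp c.κ₁) →
      ∀ b b', ‖(A σ - C⁻¹.map (algebraMap ℝ ℂ)) b b'‖ ≤ θE * Real.exp (-(kap * tdist1 Nf (locΛ b) (locΛ b'))))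
    (hsmallKθ : K₀' * (m * (1 + 2 / kap) ^ ν) * (θ * (m * (1 + 2 / kap'') ^ ν)) < 1)
    -- the (2.24)–(2.25) smallness, with `a₂₀ = m′·α₄·M⁻⁴(1 + 32/(κ₁−1))⁴`
    {cE g : ℝ} (hc0 : 0 ≤ cE) (hc : ∀ k, hC.1.eigenvalues k ≤ cE)
    (hαc : (2 * (θ * (m * (1 + 2 / kap'') ^ ν)) +
      (γ₂ + m' * c.α₄ * (c.M ^ 4)⁻¹ * (1 + 32 / (c.κ₁ - 1)) ^ 4)) * cE ≤ 1 / 2) (hg : 0 ≤ g)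
    (hΓq : ∀ X : Λ ⊕ C₀ → ℝ, (Γ₀ *ᵥ X) ⬝ᵥ (C *ᵥ (Γ₀ *ᵥ X)) ≤ g * (X ⬝ᵥ X))
    (hsmall : (2 * (θ * (m * (1 + 2 / kap'') ^ ν)) +
      (γ₂ + m' * c.α₄ * (c.M ^ 4)⁻¹ * (1 + 32 / (c.κ₁ - 1)) ^ 4)) * (1 + 2 * cE * g) ≤ 1 / 2)
    -- constant matching, p. 17, with `w = K₀(64,8)·α₄·#(⋃𝐃)`
    {a a₅ : ℝ} (hPa : a ≤ γ₂ * rP ^ 2)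
    (hvol : 2 * (K₀' * (m * (1 + 2 / kap) ^ ν) * (θ * (m * (1 + 2 / kap'') ^ ν))
              * (1 + (1 - K₀' * (m * (1 + 2 / kap) ^ ν) * (θ * (m * (1 + 2 / kap'') ^ ν)))⁻¹) / 2)
          * (Fintype.card Λ : ℝ)
        + K₀ 64 8 * c.α₄ * (((Dfam.image Subtype.val).biUnion id).card : ℝ)
        + (2 * (θ * (m * (1 + 2 / kap'') ^ ν)) +
            (γ₂ + m' * c.α₄ * (c.M ^ 4)⁻¹ * (1 + 32 / (c.κ₁ - 1)) ^ 4)) * cE * (Fintype.card Λ : ℝ)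
        + (2 * (θ * (m * (1 + 2 / kap'') ^ ν)) +
            (γ₂ + m' * c.α₄ * (c.M ^ 4)⁻¹ * (1 + 32 / (c.κ₁ - 1)) ^ 4)) * (1 + 2 * cE * g)
            * (Fintype.card (Λ ⊕ C₀) : ℝ)
        ≤ a₅ * ((Z.1).card : ℝ)) :
    ‖term214 r lZ lD (core214 A Γ (F214 t.2.card χY₀ χcP Dfam V)) 0 0‖ ≤
      weight L M c Z a t * Real.exp (a₅ * ((Z.1).card : ℝ)) := by
  -- the small-field truncation of the potentials and its invisibility under χ_{Y₀}
  set V' : TDom 4 (L * N') → (Λ → ℝ) → ℂ :=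
    fun Y B => if (∀ Y ∈ Dfam, emb B ∈ W.sp1 Y) then V Y B else 0 with hV'
  have hF : F214 t.2.card χY₀ χcP Dfam V' = F214 t.2.card χY₀ χcP Dfam V :=
    F214_congr_of_small Dfam t.2.card χY₀ χcP V (fun B => ∀ Y ∈ Dfam, emb B ∈ W.sp1 Y)
      fun B hB => by by_contra h; exact hB (hχsupp B h)
  -- (2.20) for the truncated potentials, for all fields
  have ha0 : 0 ≤ (m' : ℝ) * c.α₄ * (c.M ^ 4)⁻¹ * (1 + 32 / (c.κ₁ - 1)) ^ 4 := by
    have hM0 : 0 < c.M := by linarith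
    have hk : 0 < c.κ₁ - 1 := by linarith [Real.log_pos (show (1 : ℝ) < 162 by norm_num)]
    positivity
  have hw0 : 0 ≤ K₀ 64 8 * c.α₄ * (((Dfam.image Subtype.val).biUnion id).card : ℝ) :=
    mul_nonneg (mul_nonneg (B12TreeDecay.K₀_pos 64 8).le hα.le) (Nat.cast_nonneg _)
  have h220R : ∀ B, ∑ Y ∈ Dfam, (invTau c ((tsys 4 (L * N')).dj Y))⁻¹ * ‖V' Y B‖ ≤
      (m' * c.α₄ * (c.M ^ 4)⁻¹ * (1 + 32 / (c.κ₁ - 1)) ^ 4) / 2 * (B ⬝ᵥ B) +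
        K₀ 64 8 * c.α₄ * (((Dfam.image Subtype.val).biUnion id).card : ℝ) := by
    intro B
    have h := h220R_of_small Dfam (fun Y => (invTau c ((tsys 4 (L * N')).dj Y))⁻¹) V
      (fun B => ∀ Y ∈ Dfam, emb B ∈ W.sp1 Y) ha0 hw0 (fun B hB => ?_) B
    · simpa only [hV'] using h
    have h' := sum_tau_norm_V_le_of_lemma2_cubes W c hrepr h143 h136 hvolk h12 hC₃ hE hε hC₁ hα hM hκ₁ hδκ Dfam ι hι
      cube hQsupp hfibc emb hBv hBv0 V hV B hB
    linarith
  -- (2.22) and the letters of the capstone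
  have h222 : ∀ B, χY₀ B * χcP B ≤
      Real.exp (-(γ₂ / 2 * rP ^ 2 * (t.2.card : ℕ)) + γ₂ / 2 * ∑ b ∈ P, B b ^ 2) := by
    intro B
    rw [← hPcard]
    exact h222_of_charFns P hγ₂ hrP χY₀ χcP hχ1 hχc B
  have hχc0 : ∀ B, 0 ≤ χcP B := fun B => by
    rw [hχc]; exact prod_nonneg fun b _ => by split_ifs <;> norm_num
  have hΨσ' : ∀ τ : TDom 4 (L * N') → ℂ, (∀ j, τ j ∈ Uτ) →
      SepHolOn Uσ (fun σ => core214 A Γ (F214 t.2.card χY₀ χcP Dfam V') σ τ) := by rw [hF]; exact hΨσ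
  have hΨτ' : ∀ σ : TPt 4 N' → ℂ, (∀ j, σ j ∈ Uσ) →
      SepHolOn Uτ (fun τ => core214 A Γ (F214 t.2.card χY₀ χcP Dfam V') σ τ) := by rw [hF]; exact hΨτ
  have h := h226_torus_of_primitives c hκ₁1 hα₆ Z t hpos hhalf hUσ hUτ hUexp hUtau hr hr' hsubτ lZ hlZ lD hlD A Γ
    χY₀ χcP hχ0 hχc0 Dfam V' hΨσ' hΨτ' hC Γ₀ hAs hA G hlin (fun B => ∑ b ∈ P, B b ^ 2) h222 hγ₂
    (fun B => sum_sq_le_dotProduct P B) h220R ha0 locΛ locN hfibΛ hfibN hkap'' h1 h2 hθE hθΓ hθC hKG hKΓ hKCs hK₀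
    hθEle hθΓle hθR1le hG hΓ₀ hCs hC216 hdΓ hdC hdE hsmallKθ hc0 hc hαc hg hΓq hsmall hPa hvol
  rwa [hF] at h

end Joiner

end Literature.MathematicalPhysics.QuantumFieldTheory.Balaban1983to89.B13Lemma3TorusBinders

end
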